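/-
Copyright (c) 2026. All rights reserved.
Released under Apache 2.0 license as described in the file LICENSE.
Authors: abc-iut cell, campaign-S prover seat abc-iut-S8 (wave 2).
-/
import Literature.IUT.LogVolume.UnitLogCount
import Literature.IUT.LogVolume.TorsionUnits
import Literature.IUT.LogVolume.RamificationInvariants
import HarnessLib

/-!
# [IUTchIV] Prop. 1.4 (ii): `μ^log(log_p(R^×)) = −(1/e + m/(ef))·log(p)`

Mochizuki, *Inter-universal Teichmüller theory IV*, RIMS manuscript (Apr. 2020; = PRIMS **57** (2021)),
§1, Proposition 1.4 (ii), kurims p. 13.  Notation of Prop. 1.4 (p. 13): `k_i/ℚ_p` finite with ring of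
integers `R_i`, "`e_i` for the ramification index of `k_i` over `ℚ_p`" (Prop. 1.2), "`R^μ_i ⊆ R^×_i` the
torsion subgroup of `R^×_i`, … `p^{f_i}` for the cardinality of the residue field of `k_i`, and `p^{m_i}`
for the order of the `p`-primary component of `R^μ_i`. Thus, the order of `R^μ_i` is equal to
`p^{m_i}·(p^{f_i} − 1)`", and `μ^log` the log-volume of Prop. 1.4 (i), "normalized [i.e., by dividing by
the degree of the finite extension] … so that `μ^log(R_i) = 0`, `μ^log(p·R_i) = −log(p)`".  Then:

  **(ii)** "We have: `μ^log(log_p(R^×_i)) = −{1/e_i + m_i/(e_i f_i)}·log(p)`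
  [cf. [AbsTopIII], Proposition 5.8, (iii)]."

This file TYPES (ii) as `Prop14ii p K` in the cell's single-field vocabulary — `logUnits K = log_p(R^×)`
(`LocalUnitLog.lean`, abc-iut-S1), `normalizedLocalLogVolume K d` = the weight-`d` log-volume
`μ^log_k(−)/d` of `LocalFieldVolume.lean` (abc-iut-S2) with `d = e·f` (`= [k : ℚ_p]`,
`FundamentalIdentity.lean`), `e = absRamificationIdx p K`, `f = residueDegree p K`
(`RamificationInvariants.lean`), `m = torsionPExp p K` (`TorsionUnits.lean`) — and PROVES it
(`prop14ii_holds`) from the Haar count `μ_k(R^×) = #R^μ·μ_k(log_p(R^×))` of `UnitLogCount.lean`,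
`μ_k(R^×) = 1 − p^{−f}` (`UnitGroupVolume.lean`, abc-iut-S2) and `#R^μ = p^m·(p^f − 1)`
(`card_torsionUnits`, abc-iut-S1): `μ_k(log_p(R^×)) = p^{−(f+m)}` (`localVolume_real_logUnits_eq_inv_pow`),
`μ^log_k(log_p(R^×)) = −(f+m)·log(p)` (`localLogVolume_logUnits_eq`), and after dividing by `d = e·f`
the printed value.  Also recorded: the consequence "`μ^log(log_p(R^×_i)) ≤ −(1/e_i)·log(p)`" used in
the proof of Prop. 1.4 (iii) (p. 14) (`normalizedLocalLogVolume_logUnits_le`).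
Classical; the [IUTchIV] locators record which printed lines are kernel-checked; nothing here bears
on the disputed [IUTchIII] Cor. 3.12.
-/

noncomputable section

open MeasureTheory Set Metric IsLocalRing
open scoped ENNReal NormedField

namespace Literature.IUT.LogVolume

variable (p : ℕ) [Fact p.Prime]
variable (K : Type*) [NontriviallyNormedField K] [instK : NormedAlgebra ℚ_[p] K] [IsUltrametricDist K]
  [ProperSpace K]

omit instK [IsUltrametricDist K] [ProperSpace K] in
/-- The roots of unity of `K` as a subset of `K` are the image of `R^μ ⊆ K^×` (`torsionUnits K`).
[claim: Mochizuki2012, status: disputed] -/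
theorem setOf_isTorsionUnit_eq_image :
    {ζ : K | IsTorsionUnit K ζ} = ((↑) : Kˣ → K) '' (torsionUnits K : Set Kˣ) := by
  ext ζ
  constructor
  · intro hζ
    rw [mem_setOf_eq] at hζ
    have hζ0 : ζ ≠ 0 := norm_pos_iff.mp (by rw [hζ.norm_eq_one]; exact one_pos)
    exact ⟨Units.mk0 ζ hζ0, (mem_torsionUnits_iff K _).mpr (by simpa using hζ), rfl⟩
  · rintro ⟨u, hu, rfl⟩
    exact (mem_torsionUnits_iff K u).mp hu

omit instK [IsUltrametricDist K] [ProperSpace K] in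
/-- `#{ζ ∈ K : ζ a root of unity} = #R^μ`. [claim: Mochizuki2012, status: disputed] -/
theorem ncard_isTorsionUnit_eq_card_torsionUnits :
    {ζ : K | IsTorsionUnit K ζ}.ncard = Nat.card (torsionUnits K) := by
  have hinj : Set.InjOn ((↑) : Kˣ → K) (torsionUnits K : Set Kˣ) := fun x _ y _ h ↦ Units.ext h
  rw [setOf_isTorsionUnit_eq_image K, hinj.ncard_image, ← Nat.card_coe_set_eq]
  rfl

include instK in
/-- The residue cardinality `q` of `LocalFieldVolume.lean` is `p^f`, `f = residueDegree p K`.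
[claim: Mochizuki2012, status: disputed] -/
theorem residueCard_eq_pow : residueCard K = p ^ residueDegree p K :=
  card_residueField p K

variable [MeasurableSpace K] [BorelSpace K]

include instK in
/-- **`μ_k(log_p(R^×)) = p^{−(f+m)}`**: from `μ_k(log_p(R^×))·#R^μ = μ_k(R^×) = 1 − p^{−f}` and
`#R^μ = p^m·(p^f − 1)` (proof of Prop. 1.4 (ii), p. 14: "`e_i f_i μ^log(R^{×μ}_i) = −(f_i + m_i)·log(p)`").
[cite: Mochizuki2012, IUTchIV Prop. 1.4 (ii) proof p. 14] -/
theorem localVolume_real_logUnits_eq_inv_pow :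
    (localVolume K (logUnits K)).toReal = ((p : ℝ) ^ (residueDegree p K + torsionPExp p K))⁻¹ := by
  have hp : p.Prime := Fact.out
  have hp0 : (0 : ℝ) < p := by exact_mod_cast hp.pos
  rw [localVolume_real_logUnits p K, ncard_isTorsionUnit_eq_card_torsionUnits K, card_torsionUnits p K,
    residueCard_eq_pow p K]
  have hq1 : 1 ≤ p ^ residueDegree p K := Nat.one_le_pow _ _ hp.pos
  have hq : (1 : ℝ) < (p : ℝ) ^ residueDegree p K := by
    have := Nat.one_lt_pow (residueDegree_pos p K).ne' hp.one_lt
    exact_mod_cast this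
  push_cast [Nat.cast_sub hq1]
  have h1 : (p : ℝ) ^ residueDegree p K - 1 ≠ 0 := by linarith
  have h2 : (p : ℝ) ^ residueDegree p K ≠ 0 := by positivity
  have h3 : (p : ℝ) ^ torsionPExp p K ≠ 0 := by positivity
  field_simp
  ring

include instK in
/-- **`μ^log_k(log_p(R^×)) = −(f + m)·log(p)`** (un-normalised log-volume).
[cite: Mochizuki2012, IUTchIV Prop. 1.4 (ii) proof p. 14] -/
theorem localLogVolume_logUnits_eq :
    localLogVolume K (logUnits K) = -(((residueDegree p K : ℝ) + torsionPExp p K) * Real.log p) := by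
  rw [localLogVolume_eq_log, localVolume_real_logUnits_eq_inv_pow p K, Real.log_inv, Real.log_pow]
  push_cast
  ring

include instK in
/-- The weight-`d` normalised log-volume of `log_p(R^×)` for ANY weight `d ≠ 0`:
`μ^log_k(log_p(R^×))/d = −((f+m)/d)·log(p)`. [cite: Mochizuki2012, IUTchIV Prop. 1.4 (ii) p. 13] -/
theorem normalizedLocalLogVolume_logUnits (d : ℕ) :
    normalizedLocalLogVolume K d (logUnits K)
      = -(((residueDegree p K : ℝ) + torsionPExp p K) * Real.log p) / d := by
  rw [normalizedLocalLogVolume_eq_div, localLogVolume_logUnits_eq p K]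

/-- **[IUTchIV] Proposition 1.4 (ii)** (kurims p. 13), for one field `k = K` with `e = absRamificationIdx`,
`f = residueDegree`, `m = torsionPExp` and the log-volume normalised by the degree `d = e·f`:
"`μ^log(log_p(R^×_i)) = −{1/e_i + m_i/(e_i f_i)}·log(p)`".
[cite: Mochizuki2012, IUTchIV Prop. 1.4 (ii) p. 13] -/
def Prop14ii : Prop :=
  normalizedLocalLogVolume K (absRamificationIdx p K * residueDegree p K) (logUnits K)
    = -(1 / (absRamificationIdx p K : ℝ)
        + (torsionPExp p K : ℝ) / ((absRamificationIdx p K : ℝ) * residueDegree p K)) * Real.log p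

include instK in
/-- **[IUTchIV] Proposition 1.4 (ii) holds.** [cite: Mochizuki2012, IUTchIV Prop. 1.4 (ii) p. 13] -/
theorem prop14ii_holds : Prop14ii p K := by
  unfold Prop14ii
  rw [normalizedLocalLogVolume_logUnits p K]
  have he : (0 : ℝ) < absRamificationIdx p K := by exact_mod_cast absRamificationIdx_pos p K
  have hf : (0 : ℝ) < residueDegree p K := by exact_mod_cast residueDegree_pos p K
  push_cast
  field_simp

include instK in
/-- **The input of Prop. 1.4 (iii)**: "by assertion (ii), we have `μ^log(log_p(R^×_i)) ≤ −(1/e_i)·log(p)`"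
(proof of Prop. 1.4 (iii), p. 14) — in the degree-`e·f` normalisation.
[cite: Mochizuki2012, IUTchIV Prop. 1.4 (iii) proof p. 14] -/
theorem normalizedLocalLogVolume_logUnits_le :
    normalizedLocalLogVolume K (absRamificationIdx p K * residueDegree p K) (logUnits K)
      ≤ -(1 / (absRamificationIdx p K : ℝ)) * Real.log p := by
  have h := prop14ii_holds p K
  unfold Prop14ii at h
  rw [h]
  have he : (0 : ℝ) < absRamificationIdx p K := by exact_mod_cast absRamificationIdx_pos p K
  have hf : (0 : ℝ) < residueDegree p K := by exact_mod_cast residueDegree_pos p K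
  have hm : (0 : ℝ) ≤ torsionPExp p K := by exact_mod_cast Nat.zero_le _
  have hlog : 0 ≤ Real.log p := Real.log_nonneg (by exact_mod_cast (Fact.out : p.Prime).one_lt.le)
  have hmef : 0 ≤ (torsionPExp p K : ℝ) / ((absRamificationIdx p K : ℝ) * residueDegree p K) :=
    div_nonneg hm (mul_pos he hf).le
  nlinarith

end Literature.IUT.LogVolume

end
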